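import Literature.Analysis.FluidPDE.NormalisedPressure
import HarnessLib

/-!
# The normalised pressure under linear isometries (axisymmetric fields have axisymmetric pressure)

Analysis/FluidPDE support file (serves the formalisation of Scheffer's construction of singular
weak solutions of the Navier–Stokes inequality in the presentation of W. S. Ożański,
arXiv:1709.00602, §3.2, eq. (3.6): "the pressure function corresponding to an axisymmetric vector
field is axisymmetric", used throughout §§3–5 there; companion of the accepted
`NormalisedPressureAffine` (similarities `x ↦ x₀ + γx`)).

For the normalised (Riesz-transform) pressure `p̃[v] = -Δ⁻¹∂ᵢ∂ⱼ(vᵢvⱼ)` of the accepted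
`NormalisedPressure.lean` (realised pointwise by the principal value
`p̃[v](x) = -|v(x)|²/d + p.v.∫ K(x-y)(v y) dy`) and a linear isometry `R : E ≃ₗᵢ[ℝ] E` we prove,
for EVERY velocity slice `v : E → E` (no regularity assumed; the junk branch is covariant too):

* `pressureKernel_linearIsometryEquiv` — `K(Rz)(Ra) = K(z)(a)` (the kernel only sees `⟪z,a⟫`, `|z|`, `|a|`);
* `truncatedPressureIntegral_conj_linearIsometryEquiv` — for the conjugated ("rotated") field
  `v^R := R ∘ v ∘ R⁻¹`, `∫_{|x-y|>ε} K(x-y)(v^R y) dy = ∫_{|R⁻¹x-w|>ε} K(R⁻¹x-w)(v w) dw`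
  (change of variables `y = Rw`, `R` measure preserving — Ożański's computation (3.6));
* `hasPressurePV_conj_linearIsometryEquiv_iff`, `normalisedPressure_conj_linearIsometryEquiv` —
  **`p̃[R ∘ v ∘ R⁻¹](x) = p̃[v](R⁻¹x)`**;
* `normalisedPressure_comp_linearIsometryEquiv_of_equivariant` — if `v` is `R`-equivariant
  (`v(Ry) = R v(y)`, e.g. axisymmetric fields and the rotations about their axis) then `p̃[v]` is
  `R`-invariant: `p̃[v](Rx) = p̃[v](x)` (Ożański 2017, (3.6)).

## Mathlib search

`LinearIsometryEquiv.measurePreserving`, `MeasurePreserving.integral_comp'`,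
`MeasurePreserving.integrableOn_comp_preimage`, `LinearIsometryEquiv.toMeasurableEquiv` (used);
nothing on Riesz transforms.

## References

* W. S. Ożański, *On weak solutions to the Navier–Stokes inequality with internal
  singularities*, arXiv:1709.00602 (2017), §3.2 (3.6). [`Ozanski2017NSISingular`]
* E. M. Stein, *Singular integrals and differentiability properties of functions* (1970),
  Ch. III §1 (rotation invariance of the Riesz transforms). [`Stein1970`]
-/

noncomputable section

open MeasureTheory Set Filter Metric Topology Function
open scoped RealInnerProductSpace

namespace Literature.Analysis.FluidPDE

variable {E : Type*} [NormedAddCommGroup E] [InnerProductSpace ℝ E] [FiniteDimensional ℝ E]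
  [MeasurableSpace E] [BorelSpace E]

/-! ### Invariance of the kernel -/

/-- **The pressure kernel is `O(d)`-invariant**: `K(Rz)(Ra) = K(z)(a)` for a linear isometry
`R` (`K(z)(a) = (d⟨z,a⟩² - |a|²|z|²)/(ω_d|z|^{d+2})` depends on `z, a` through `⟨z,a⟩`, `|z|`,
`|a|` only). [folklore] -/
theorem pressureKernel_linearIsometryEquiv (R : E ≃ₗᵢ[ℝ] E) (z a : E) :
    pressureKernel (R z) (R a) = pressureKernel z a := by
  simp only [pressureKernel, LinearIsometryEquiv.inner_map_map, LinearIsometryEquiv.norm_map]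

/-! ### The truncated integrals and the principal value of the rotated field -/

/-- **Truncated singular integrals of the rotated field** `v^R = R ∘ v ∘ R⁻¹`:
`∫_{|x-y|>ε} K(x-y)(R v(R⁻¹y)) dy = ∫_{|R⁻¹x-w|>ε} K(R⁻¹x-w)(v w) dw` (substitute `y = Rw`; `R`
preserves Lebesgue measure, balls and the kernel; Ożański 2017, (3.6)). No hypothesis on `v`.
[cite: Ozanski2017NSISingular, §3.2 (3.6)] -/
theorem truncatedPressureIntegral_conj_linearIsometryEquiv (R : E ≃ₗᵢ[ℝ] E) (v : E → E) (x : E) (ε : ℝ) :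
    truncatedPressureIntegral (fun y => R (v (R.symm y))) x ε =
      truncatedPressureIntegral v (R.symm x) ε := by
  simp only [truncatedPressureIntegral]
  rw [← integral_indicator measurableSet_closedBall.compl,
    ← integral_indicator measurableSet_closedBall.compl]
  have hmp := R.measurePreserving
  -- substitute `y = R w`
  have h := hmp.integral_comp' (f := R.toMeasurableEquiv)
    (g := (closedBall x ε)ᶜ.indicator fun y => pressureKernel (x - y) (R (v (R.symm y))))
  rw [← h]
  refine integral_congr_ae (Eventually.of_forall fun w => ?_)
  simp only [LinearIsometryEquiv.coe_toMeasurableEquiv]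
  have hmem : R w ∈ (closedBall x ε)ᶜ ↔ w ∈ (closedBall (R.symm x) ε)ᶜ := by
    simp only [mem_compl_iff, mem_closedBall]
    rw [← R.dist_map w (R.symm x), LinearIsometryEquiv.apply_symm_apply]
  by_cases hw : w ∈ (closedBall (R.symm x) ε)ᶜ
  · rw [indicator_of_mem (hmem.2 hw), indicator_of_mem hw, LinearIsometryEquiv.symm_apply_apply]
    have : x - R w = R (R.symm x - w) := by
      rw [map_sub, LinearIsometryEquiv.apply_symm_apply]
    rw [this, pressureKernel_linearIsometryEquiv]
  · rw [indicator_of_notMem (fun h' => hw (hmem.1 h')), indicator_of_notMem hw]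

/-- Integrability of the truncated integrands of the rotated field corresponds to that of the
original field at the rotated point. [folklore] -/
theorem integrableOn_pressureKernel_conj_linearIsometryEquiv_iff (R : E ≃ₗᵢ[ℝ] E) (v : E → E) (x : E)
    (ε : ℝ) :
    IntegrableOn (fun y => pressureKernel (x - y) (R (v (R.symm y)))) (closedBall x ε)ᶜ volume ↔
      IntegrableOn (fun w => pressureKernel (R.symm x - w) (v w)) (closedBall (R.symm x) ε)ᶜ
        volume := by
  have hmp := R.measurePreserving
  have hme : MeasurableEmbedding R := R.toMeasurableEquiv.measurableEmbedding
  have key := hmp.integrableOn_comp_preimage hme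
    (f := fun y => pressureKernel (x - y) (R (v (R.symm y)))) (s := (closedBall x ε)ᶜ)
  have hpre : (R : E → E) ⁻¹' (closedBall x ε)ᶜ = (closedBall (R.symm x) ε)ᶜ := by
    ext w
    simp only [mem_preimage, mem_compl_iff, mem_closedBall]
    rw [← R.dist_map w (R.symm x), LinearIsometryEquiv.apply_symm_apply]
  have hfun : ((fun y => pressureKernel (x - y) (R (v (R.symm y)))) ∘ (R : E → E)) =
      fun w => pressureKernel (R.symm x - w) (v w) := by
    funext w
    simp only [comp_apply, LinearIsometryEquiv.symm_apply_apply]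
    have : x - R w = R (R.symm x - w) := by
      rw [map_sub, LinearIsometryEquiv.apply_symm_apply]
    rw [this, pressureKernel_linearIsometryEquiv]
  rw [hpre, hfun] at key
  exact key.symm

/-- **Principal values of the rotated field**: `p.v.∫ K(x-y)(R v(R⁻¹y)) dy` exists iff
`p.v.∫ K(R⁻¹x-w)(v w) dw` does, with the same value. [cite: Stein1970, Ch. III §1] -/
theorem hasPressurePV_conj_linearIsometryEquiv_iff (R : E ≃ₗᵢ[ℝ] E) (v : E → E) (x : E) (L : ℝ) :
    HasPressurePV (fun y => R (v (R.symm y))) x L ↔ HasPressurePV v (R.symm x) L := by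
  have hT : truncatedPressureIntegral (fun y => R (v (R.symm y))) x =
      truncatedPressureIntegral v (R.symm x) :=
    funext (truncatedPressureIntegral_conj_linearIsometryEquiv R v x)
  simp only [HasPressurePV, hT, integrableOn_pressureKernel_conj_linearIsometryEquiv_iff R v x]

/-! ### The normalised pressure of rotated and of equivariant fields -/

/-- **`p̃` commutes with linear isometries**: `p̃[R ∘ v ∘ R⁻¹](x) = p̃[v](R⁻¹ x)` for every linear
isometry `R`, every field `v` and every point `x` (both sides are the junk `0` together off the
admissible locus; Stein 1970, Ch. III §1; Ożański 2017, (3.6)). [cite: Ozanski2017NSISingular, §3.2 (3.6)] -/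
theorem normalisedPressure_conj_linearIsometryEquiv (R : E ≃ₗᵢ[ℝ] E) (v : E → E) (x : E) :
    normalisedPressure (fun y => R (v (R.symm y))) x = normalisedPressure v (R.symm x) := by
  by_cases h : ∃ L, HasPressurePV v (R.symm x) L
  · obtain ⟨L, hL⟩ := h
    rw [normalisedPressure_eq hL,
      normalisedPressure_eq ((hasPressurePV_conj_linearIsometryEquiv_iff R v x L).2 hL),
      LinearIsometryEquiv.norm_map]
  · have h' : ¬ ∃ L, HasPressurePV (fun y => R (v (R.symm y))) x L := fun ⟨L, hL⟩ =>
      h ⟨L, (hasPressurePV_conj_linearIsometryEquiv_iff R v x L).1 hL⟩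
    rw [normalisedPressure_eq_zero_of_not_exists h, normalisedPressure_eq_zero_of_not_exists h']

/-- **The pressure of an equivariant field is invariant** (Ożański 2017, (3.6): "the pressure
function corresponding to an axisymmetric vector field is axisymmetric"): if `v(Ry) = R v(y)`
for all `y`, then `p̃[v](Rx) = p̃[v](x)` for all `x`. For an axisymmetric field take for `R` the
rotations about the axis. [cite: Ozanski2017NSISingular, §3.2 (3.6)] -/
theorem normalisedPressure_comp_linearIsometryEquiv_of_equivariant (R : E ≃ₗᵢ[ℝ] E) {v : E → E}
    (hv : ∀ y, v (R y) = R (v y)) (x : E) :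
    normalisedPressure v (R x) = normalisedPressure v x := by
  have hconj : (fun y => R (v (R.symm y))) = v := by
    funext y
    rw [← hv, LinearIsometryEquiv.apply_symm_apply]
  have := normalisedPressure_conj_linearIsometryEquiv R v (R x)
  rwa [hconj, LinearIsometryEquiv.symm_apply_apply] at this

/-- Function form: an `R`-equivariant field has an `R`-invariant normalised pressure,
`p̃[v] ∘ R = p̃[v]`. [cite: Ozanski2017NSISingular, §3.2 (3.6)] -/
theorem normalisedPressure_comp_linearIsometryEquiv_of_equivariant' (R : E ≃ₗᵢ[ℝ] E) {v : E → E}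
    (hv : ∀ y, v (R y) = R (v y)) :
    normalisedPressure v ∘ R = normalisedPressure v :=
  funext (normalisedPressure_comp_linearIsometryEquiv_of_equivariant R hv)

end Literature.Analysis.FluidPDE

end
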